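import Literature.Probability.FitznerVanDerHofstad2017.LabelledDisjointOccurrence

/-!
# [FvdH17] §4.2 Def. 4.1: labelled disjoint occurrence — RELABELLING the configurations
(exchangeability of the i.i.d. configurations; unused configurations integrate out)

Source: R. Fitzner, R. van der Hofstad, *Mean-field behavior for nearest-neighbor percolation in `d > 10`*,
Electron. J. Probab. **22** (2017) no. 43 [FvdH17], §4.2 Def. 4.1 and (4.16)–(4.17) (arXiv:1506.07977v2 pp. 35–36 =
EJP p. 33): the repulsive letters are MAXIMA over configuration assignments of `ℙ_p(⊛_i {x_{i-1} ←j_i→ x_i}_{c_i})`,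
"where `ω₁,ω₂,ω₃` are three i.i.d. percolation configurations under `ℙ_p`"; (4.16) fixes the first line on
configuration `1` ("`max_{i=1,2} ℙ_p({0 ←j₁→ x₁}₁ ⊛ {x₁ ←j₂→ x₂}_i)`").

Two bookkeeping facts used (silently) whenever a group of lines of a larger diagram is compared with such a maximum
(§6.1: "it is straightforward to obtain that …", p. 49): for the labelled event `⊛_i (A_i)_{c_i}`
(`LabelledDisjointOccurrence.genDisjOcc A c`) on `k` i.i.d. configurations with common law `μ`,

* EXCHANGEABILITY (`pi_genDisjOcc_perm`): for a permutation `σ` of the labels,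
  `μ^{⊗k}(⊛_i (A_i)_{σ(c_i)}) = μ^{⊗k}(⊛_i (A_i)_{c_i})` — so the first line of a group may be put on configuration `1`;
* MARGINALS (`pi_genDisjOcc_castLE`): if the labels take values in the first `k ≤ k'` configurations,
  `μ^{⊗k'}(⊛_i (A_i)_{c_i}) = μ^{⊗k}(⊛_i (A_i)_{c_i})` — unused configurations integrate out; so a group using at most
  `n` of the configurations of a big diagram is a member of the maximum over assignments into `n` configurations.

Both are proved for an arbitrary probability measure `μ` on configurations and arbitrary events `A_i` (no
monotonicity or measurability is needed: the relabelling maps are measurable EQUIVALENCES —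
`MeasurableEquiv.piCongrLeft`, `MeasurableEquiv.piEquivPiSubtypeProd` — and a product rectangle).  An arbitrary
injective relabelling `Fin k ↪ Fin k'` is a permutation followed by the initial-segment inclusion `Fin.castLE`, so the
two lemmas cover it.  Nothing in this module is a cited hypothesis; nothing is specific to percolation or to a
dimension.
-/

noncomputable section

namespace Literature.Probability.FitznerVanDerHofstad2017

open _root_.MeasureTheory Literature.Probability.Percolation

variable {V : Type*} {k k' : ℕ} {ι : Type*}

/-! ### A. Relabelling as a preimage -/

/-- Relabelling the configurations of `⊛_i (A_i)_{c_i}` along `f` is the preimage under `ω ↦ ω ∘ f`.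
[cite: FitznerVanDerHofstad2017, §4.2 Def. 4.1 (arXiv:1506.07977v2 p. 35)] -/
theorem genDisjOcc_comp_eq_preimage (f : Fin k → Fin k') (A : ι → Set (BondConfig V)) (c : ι → Fin k) :
    genDisjOcc A (f ∘ c) = (fun ω : Fin k' → BondConfig V => ω ∘ f) ⁻¹' genDisjOcc A c := by
  ext ω; simp only [Set.mem_preimage, mem_genDisjOcc_iff, Function.comp_apply]

/-- The measurable equivalence `piCongrLeft` on a constant family acts by `ω ↦ ω ∘ e⁻¹`. [folklore] -/
theorem coe_piCongrLeft_const (X : Type*) [MeasurableSpace X] {α β : Type*} (e : α ≃ β) :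
    ⇑(MeasurableEquiv.piCongrLeft (fun _ : β => X) e) = fun ω => ω ∘ e.symm := by
  funext ω
  funext b
  have h := Equiv.piCongrLeft_apply_apply (P := fun _ : β => X) e ω (e.symm b)
  simp only [Equiv.apply_symm_apply] at h
  simpa [MeasurableEquiv.piCongrLeft] using h

/-! ### B. Exchangeability -/

/-- **Exchangeability of the i.i.d. configurations**: `μ^{⊗k}(⊛_i (A_i)_{σ(c_i)}) = μ^{⊗k}(⊛_i (A_i)_{c_i})` for every
permutation `σ` of the labels. [cite: FitznerVanDerHofstad2017, §4.2 Def. 4.1 and (4.16)–(4.17) (arXiv:1506.07977v2 pp. 35–36)] -/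
theorem pi_genDisjOcc_perm (μ : Measure (BondConfig V)) [IsProbabilityMeasure μ] (σ : Equiv.Perm (Fin k))
    (A : ι → Set (BondConfig V)) (c : ι → Fin k) :
    Measure.pi (fun _ : Fin k => μ) (genDisjOcc A (σ ∘ c)) = Measure.pi (fun _ : Fin k => μ) (genDisjOcc A c) := by
  rw [genDisjOcc_comp_eq_preimage]
  have hmp := MeasureTheory.measurePreserving_piCongrLeft (fun _ : Fin k => μ) σ.symm
  have hcoe := coe_piCongrLeft_const (BondConfig V) σ.symm
  simp only [Equiv.symm_symm] at hcoe
  rw [← hcoe]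
  exact hmp.measure_preimage_equiv _

/-! ### C. Marginals: unused configurations integrate out -/

/-- The coordinates `< k` of `Fin k'` are `Fin k` (`k ≤ k'`). [folklore] -/
def finSubtypeLtEquiv (h : k ≤ k') : {i : Fin k' // (i : ℕ) < k} ≃ Fin k where
  toFun i := ⟨i.1, i.2⟩
  invFun j := ⟨Fin.castLE h j, j.2⟩
  left_inv i := by ext; rfl
  right_inv j := by ext; rfl

/-- Marginal of a product of `k'` copies of a probability measure on the first `k` coordinates:
`μ^{⊗k'}((· ∘ castLE)⁻¹ S) = μ^{⊗k}(S)` for EVERY set `S` (no measurability needed). [folklore] -/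
theorem pi_preimage_comp_castLE (X : Type*) [MeasurableSpace X] (μ : Measure X) [IsProbabilityMeasure μ]
    (h : k ≤ k') (S : Set (Fin k → X)) :
    Measure.pi (fun _ : Fin k' => μ) ((fun ω : Fin k' → X => ω ∘ Fin.castLE h) ⁻¹' S) =
      Measure.pi (fun _ : Fin k => μ) S := by
  classical
  set p : Fin k' → Prop := fun i => (i : ℕ) < k with hp
  have e1 := MeasureTheory.measurePreserving_piEquivPiSubtypeProd (fun _ : Fin k' => μ) p
  have e2 := MeasureTheory.measurePreserving_piCongrLeft (fun _ : Fin k => μ) (finSubtypeLtEquiv h)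
  set Ψ : ({i : Fin k' // p i} → X) → (Fin k → X) :=
    ⇑(MeasurableEquiv.piCongrLeft (fun _ : Fin k => X) (finSubtypeLtEquiv h)) with hΨ
  have hΨapply : ∀ (ω : {i : Fin k' // p i} → X) (j : Fin k), Ψ ω j = ω ⟨Fin.castLE h j, j.2⟩ := by
    intro ω j
    rw [hΨ, coe_piCongrLeft_const]
    rfl
  have hset : ((fun ω : Fin k' → X => ω ∘ Fin.castLE h) ⁻¹' S) =
      ⇑(MeasurableEquiv.piEquivPiSubtypeProd (fun _ : Fin k' => X) p) ⁻¹' ((Ψ ⁻¹' S) ×ˢ Set.univ) := by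
    ext ω
    simp only [Set.mem_preimage, Set.mem_prod, Set.mem_univ, and_true]
    have hfun : Ψ ((MeasurableEquiv.piEquivPiSubtypeProd (fun _ : Fin k' => X) p) ω).1 = ω ∘ Fin.castLE h := by
      funext j
      rw [hΨapply]
      rfl
    rw [hfun]
  rw [hset, e1.measure_preimage_equiv, Measure.prod_prod, measure_univ, mul_one]
  exact e2.measure_preimage_equiv S

/-- **Unused configurations integrate out**: if the labels take values in the first `k ≤ k'` configurations,
`μ^{⊗k'}(⊛_i (A_i)_{c_i}) = μ^{⊗k}(⊛_i (A_i)_{c_i})`.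
[cite: FitznerVanDerHofstad2017, §4.2 Def. 4.1 and (4.16)–(4.17) (arXiv:1506.07977v2 pp. 35–36)] -/
theorem pi_genDisjOcc_castLE (μ : Measure (BondConfig V)) [IsProbabilityMeasure μ] (h : k ≤ k')
    (A : ι → Set (BondConfig V)) (c : ι → Fin k) :
    Measure.pi (fun _ : Fin k' => μ) (genDisjOcc A (Fin.castLE h ∘ c)) =
      Measure.pi (fun _ : Fin k => μ) (genDisjOcc A c) := by
  rw [genDisjOcc_comp_eq_preimage]
  exact pi_preimage_comp_castLE (BondConfig V) μ h _

/-! ### D. Rectangles: the level product of (4.65) as one event on two configurations -/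

/-- `μ^{⊗2}({ω | ω₀ ∈ E₀, ω₁ ∈ E₁}) = μ(E₀) μ(E₁)` — the two independent levels of [FvdH17] (4.65) ("The
probabilities in (4.65) factor as the events `F_0,…,F_N` occur on different percolation configurations and are
thus independent") read as ONE event on `μ ⊗ μ`. [cite: FitznerVanDerHofstad2017, §4.4 (4.65) (arXiv:1506.07977v2 p. 43)] -/
theorem pi_two_setOf_mem_and (X : Type*) [MeasurableSpace X] (μ : Measure X) [IsProbabilityMeasure μ]
    (E₀ E₁ : Set X) :
    Measure.pi (fun _ : Fin 2 => μ) {ω | ω 0 ∈ E₀ ∧ ω 1 ∈ E₁} = μ E₀ * μ E₁ := by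
  have hset : {ω : Fin 2 → X | ω 0 ∈ E₀ ∧ ω 1 ∈ E₁} = Set.pi Set.univ ![E₀, E₁] := by
    ext ω
    simp only [Set.mem_setOf_eq, Set.mem_pi, Set.mem_univ, forall_const, Fin.forall_fin_two,
      Matrix.cons_val_zero, Matrix.cons_val_one]
  rw [hset, Measure.pi_pi, Fin.prod_univ_two]
  simp only [Matrix.cons_val_zero, Matrix.cons_val_one]

end Literature.Probability.FitznerVanDerHofstad2017

end
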